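import Literature.MathematicalPhysics.QuantumFieldTheory.Balaban1983to89.B9Eq357Levels
import Literature.MathematicalPhysics.QuantumFieldTheory.Balaban1983to89.B7Eq214GeneralQprime
import Literature.MathematicalPhysics.QuantumFieldTheory.Balaban1983to89.B8Eq178Averages
import Literature.MathematicalPhysics.QuantumFieldTheory.Balaban1983to89.B9Eq3114Proof

/-!
# `Balaban1983to89.B7Eq212CollapsedGeneral` — T. Bałaban, *Averaging operations for lattice gauge theories*, Commun. Math.
# Phys. **98** (1985) 17–51 [Balaban1985Averaging], (212) p. 50: the linear operator `Q′_j` AT A GENERAL BACKGROUND in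
# print's COLLAPSED form `(Q′_jλ)(y) = Σ_{x∈Bʲ(y)} L^{−jd}R(U₀(Γ^{(j)}_{y,x}))λ(x)`, PROVED for the `ℤᵈ` carrier
# `B7Eq214General.lamAvgG`, and the agreement of the tree's five encodings of `Q′_j(U₀)`

statement-level skeleton of published theorems with citation tags; proofs where landed; nothing here is a claim about the Yang–Mills mass gap

PDF held: `paper:balaban1985-cmp98-averaging` (journal page = PDF page + 16); render `…/1985-cmp98-averaging-p034-x2.png`
(p. 50) read as an image by the unit.  Companion source for the collapsed sum: T. Bałaban, *Propagators for lattice gauge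
theories in a background field*, Commun. Math. Phys. **99** (1985) 389–434 [Balaban1985BackgroundPropagators], (3.19) p. 393
and (3.55) p. 401 (`paper:balaban1985-cmp99-background-propagators`).

CITATION HEADER (lean-in-tree rule).  Cell `lit-balaban` (HOME `run/shared/lean/pub/lit-balaban/`), PHASE-2 proof seat
`lit-balaban-p40` (gen 3) — KERNEL PIECE for SKELETON row `B7.Eq212` (owner `lit-balaban-r04`; decl of record
`B7Eq78Linearization.QprimeIter`), the owner's HANDOFF follow-up (ii) «print's collapsed form of (212)
`Σ_{x∈Bʲ(y)}L^{−jd}R(U₀(Γ^{(j)}_{y,x}))λ(x)` @gen» (flat companion: p22's `B7Eq214FlatQprime.lamAvg_eq_sum_blockSites`).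

PRINT (p. 50, verbatim): "By (179) the function `Q′_j(u₁, λ)` is a composition of one-step functions and from the above
formula we can easily see that
`Q′_j(u₁, λ, y) = Σ_{x∈Bʲ(y)} L^{−jd}R(U₀(Γ^{(j)}_{y,x}))λ(x) + Σ_{l=0}^{j−1}·O(C₅α₄2α₄Lˡη + α₃2α₄(Lˡη)² + 4α₄²(Lˡη)²)`, (212)
hence `Q′_j(u₁, λ, y) = (Q′_jλ)(y) + C′_j(u₁, λ, y)`, (213) `|C′_j(u₁, λ, y)| = O((α₃α₄ + α₄²)Lʲη)`. (214)"
Here `R(X)Y = XYX⁻¹` ((56) p. 27) and `U₀(Γ^{(j)}_{y,x})` is the composite contour variable of (77) p. 30,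
"`R(U₀(Γ^{(j+1)}_{x_{j+1},x})) = R̄ʲ_{0,x_{j+1}}⋯R̄_{0,x₂}R_{0,x₁}`", i.e. [Balaban1985BackgroundPropagators] (3.55) p. 401
"`U(Γ^{(j)}_{y,x}) = Ū^{j−1}(Γ_{y,x_{j−1}})·…·Ū(Γ_{x₂,x₁})U(Γ_{x₁,x})`, … `x_l ∈ B(x_{l+1})`" — the tree's
`B9Eq358Decomposition.compT L U₀ j y x`; and (3.19) p. 393 "`(Q′_j(U)λ)(y) = (Q′(Ū^{j−1})·…·Q′(Ū)Q′(U)λ)(y) =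
Σ_{x∈B^j(y)} L^{−jd}R(U(Γ^{(j)}_{y,x}))λ(x)`" is the same operator with both forms displayed.

WHAT THIS FILE PROVES (kernel, no `sorry`, standard axioms; no definition, no Prop-valued fact).
§1 `rlam_eq_Qp` — the one step of (212) at a background `V₀`, r04's rotated block mean `B7Eq214General.rlam L V₀`
   ((211): `Σ_{x∈B(y)} L^{−d}(R_{0,y}f)(x)`), IS p06's one-step operator `B9Eq3113Proof.Qp L V₀` of (3.19) (and p12's
   `B9Eq3114Proof.P12.Qp`), definitionally.
§2 `lamAvgG_eq_QpIter` — hence the composite `Q′_j = B7Eq214General.lamAvgG L U₀ j` (recursion (77)/(80) over the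
   averaged backgrounds `Ū₀ˡ = B7Prop2Explicit.avgIter L U₀ l`) IS `B9Eq3113Proof.QpIter L U₀ · j` (first form of (3.19));
   `QpIterP12_eq_QpIter` likewise for p12's carrier.
§3 **(212) COLLAPSED, AT A GENERAL BACKGROUND** — for `L ≥ 1`, every `U₀ : ℤᵈ → (Fin d → 𝔸ˣ)`, `λ : ℤᵈ → 𝔸`, `j`, `y`:
   `eq212_collapsed`: `lamAvgG L U₀ j λ y = Σ_{x ∈ blockSites (L^j) y} L^{−jd} • R(compT L U₀ j y x)λ(x)` (print's
   `Σ_{x∈Bʲ(y)}`, `Bʲ(y) = QuantumLattice.blockSites (L^j) y = L^jy + [0, L^j)ᵈ`); `eq212_collapsed_bsite`: the same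
   sum parametrised by the offsets `r ∈ [0, L^j)ᵈ` (`B9Eq358Decomposition.bsite`), i.e. `lamAvgG_eq_QpC`:
   `lamAvgG L U₀ j λ y = B9Eq358Decomposition.QpC L U₀ j λ y`.  MECHANISM = print's "composition of one-step functions":
   §2 + p06's level-peeling `B9Eq357Levels.QpC_eq_QpIter` ((3.55) from the top).  At `U₀ = 1` all transporters are `1`
   (`compT_one_left`) and the statement is p22's flat `lamAvg_eq_sum_blockSites` (`QpC_one_left`).
§4 THE FIVE TREE ENCODINGS OF `Q′_j(U₀)` AGREE pointwise, for every `L, U₀, λ, j`: r04's `lamAvgG L U₀ j λ` =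
   r04's `QprimeIter (zdBlocking d L) (transp L U₀) j λ` (`B7Eq214GeneralQprime.lamAvgG_eq_QprimeIter`) = r05's
   `QprimeIter (zdBlocking d L) (bgT L U₀) j λ` (`B8Eq178Averages.qprimeIter_bgT_eq_lamAvgG`) = p06's
   `B9Eq3113Proof.QpIter L U₀ λ j` = p12's `B9Eq3114Proof.P12.QpIter L U₀ λ j` (§2), and for `L ≥ 1` all equal the
   collapsed `QpC L U₀ j λ` (§3): `qprimeIter_transp_eq_QpIter`, `qprimeIter_bgT_eq_QpIter`, `qprimeIter_transp_eq_bgT`,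
   `qprimeIter_transp_eq_QpC`, `qprimeIter_bgT_eq_QpC`, `QpIterP12_eq_QpC`.
§5 (213)–(214) AT A GENERAL BACKGROUND WITH THE COLLAPSED OPERATOR — r04's `B7Eq214General.eq214_general_of52`
   restated through §3/§2 for the B9-side consumers: `eq214_general_QpC`, `eq214_general_QpIter`
   (`‖log ũ′ʲ(z) − (Q′_jλ)(z)‖ ≤ C′_gen(α₃α₄ + α₄²)LʲL^{−k}` with `Q′_jλ = QpC L U₀ j λ`, resp. `B9Eq3113Proof.QpIter L U₀ λ j`).
READINGS: those of `B7Eq214General` / `B9Eq358Decomposition`; nothing new.  HONEST SCOPE: (i) the `O(·)` remainder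
column of (212) is (213)–(214), proved @gen by r04 (`eq212_general`, `eq214_general_of52`) — only restated here (§5);
(ii) `L ≥ 1` is needed for the collapse (for `L = 0` the blocks are empty while `lamAvgG L U₀ 0 λ = λ`); (iii) no torus /
finite-volume reading (the carriers are the `ℤᵈ` ones of the B7/B8/B9 @gen lineage).
DECLARATIONS: 0 definitions, 16 theorems.  Imports: `B9Eq357Levels` (p06: `QpC`, `compT`, `bsite`, `QpC_eq_QpIter`),
`B7Eq214GeneralQprime` (r04: `transp`, `lamAvgG_eq_QprimeIter`; → `B7Eq214General`), `B8Eq178Averages` (r05: `bgT` form),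
`B9Eq3114Proof` (p12's carrier).  Unit `lit-balaban-p40` (gen 3), 2026-08-21.

[cite: Balaban1985Averaging, (212)–(214) p.50, (77)–(80) p.30; Balaban1985BackgroundPropagators, (3.19) p.393, (3.55) p.401]
-/

noncomputable section

open NormedSpace Finset

namespace Literature.MathematicalPhysics.QuantumFieldTheory.Balaban1983to89.B7Eq212CollapsedGeneral

open B7Prop1Explicit B7Prop2Explicit MatrixLog B7Eq92Concrete B7Eq167Flat B7Eq170Flat B7Prop9Flat B7Prop9General
  B7Prop10General B7Eq214Flat B7Eq214General
open B7Eq78Linearization (QprimeIter zdBlocking conjR conjR_apply)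
open B7Eq214GeneralQprime (transp lamAvgG_eq_QprimeIter)
open B8Eq119TwistedAxial (bgT)
open B8Eq178Averages (qprimeIter_bgT_eq_lamAvgG)
open B9Eq358Decomposition (compT bsite QpC)
open B9Eq357Levels (QpC_eq_QpIter)
open Literature.MathematicalPhysics.QuantumLattice (blockSites)
open B7Eq214FlatQprime (sum_blockSites_eq_sum_boxVec)

-- `Site` alone would resolve to the torus sites of `Setup.lean`; re-export the `ℤ^d` sites of `B7Prop1Explicit`.
export B7Prop1Explicit (Site)

variable {d : ℕ}

variable {𝔸 : Type*} [NormedRing 𝔸] [NormedAlgebra ℂ 𝔸] [CompleteSpace 𝔸]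

/-! ## §1 The one step of (212): r04's rotated block mean IS the one-step operator `Q′(V₀)` of (3.19) -/

omit [CompleteSpace 𝔸] in
/-- **(211)/(212), one step**: `Σ_{x∈B(y)} L^{−d}(R_{0,y}f)(x) = (Q′(V₀)f)(y)` — r04's `rlam L V₀ f y` (block mean `bmean`
of the conjugated values `cj (V₀(Γ_{y,x})) (f x)`) and p06's `B9Eq3113Proof.Qp L V₀ f y` (`Σ_r L^{−d} • conjR (V₀(Γ_{y,x_r})) (f x_r)`)
are the same expression. [cite: Balaban1985Averaging, (211)–(212) p.50; Balaban1985BackgroundPropagators, (3.19) p.393] -/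
theorem rlam_eq_Qp (L : ℕ) (V₀ : Site d → Fin d → 𝔸ˣ) (f : Site d → 𝔸) (y : Site d) :
    rlam L V₀ f y = B9Eq3113Proof.Qp L V₀ f y := rfl

omit [CompleteSpace 𝔸] in
/-- The same for p12's one-step carrier `B9Eq3114Proof.P12.Qp`. [cite: Balaban1985Averaging, (211)–(212) p.50;
Balaban1985BackgroundPropagators, (3.19) p.393] -/
theorem rlam_eq_QpP12 (L : ℕ) (V₀ : Site d → Fin d → 𝔸ˣ) (f : Site d → 𝔸) (y : Site d) :
    rlam L V₀ f y = B9Eq3114Proof.P12.Qp L V₀ f y := rfl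

/-! ## §2 The composite: `lamAvgG` IS `QpIter` ("`Q′_j(u₁, λ)` is a composition of one-step functions", (179)/(77)) -/

/-- **`Q′_j` @gen, composite form**: r04's `lamAvgG L U₀ j λ` (recursion `(Q′_{j+1}λ)(z) = (Q′(Ū₀ʲ)Q′_jλ)(Lz)`, (77)/(80))
IS p06's `B9Eq3113Proof.QpIter L U₀ λ j` (first form of (3.19), same recursion over `Ū₀ʲ = avgIter L U₀ j`).
[cite: Balaban1985Averaging, (212) p.50, (77)–(80) p.30; Balaban1985BackgroundPropagators, (3.19) p.393] -/
theorem lamAvgG_eq_QpIter (L : ℕ) (U₀ : Site d → Fin d → 𝔸ˣ) (lam : Site d → 𝔸) :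
    ∀ j : ℕ, lamAvgG L U₀ j lam = B9Eq3113Proof.QpIter L U₀ lam j
  | 0 => rfl
  | j + 1 => by
    funext z
    rw [lamAvgG_succ, B9Eq3113Proof.QpIter_succ, lamAvgG_eq_QpIter L U₀ lam j, rlam_eq_Qp]

/-- p12's composite carrier `B9Eq3114Proof.P12.QpIter` IS p06's `B9Eq3113Proof.QpIter` (same recursion).
[cite: Balaban1985BackgroundPropagators, (3.19) p.393] -/
theorem QpIterP12_eq_QpIter (L : ℕ) (U₀ : Site d → Fin d → 𝔸ˣ) (lam : Site d → 𝔸) :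
    ∀ j : ℕ, B9Eq3114Proof.P12.QpIter L U₀ lam j = B9Eq3113Proof.QpIter L U₀ lam j
  | 0 => rfl
  | j + 1 => by
    funext z
    rw [B9Eq3114Proof.P12.QpIter_succ, B9Eq3113Proof.QpIter_succ, QpIterP12_eq_QpIter L U₀ lam j]
    rfl

/-- Hence r04's `lamAvgG` IS p12's `P12.QpIter` as well. [cite: Balaban1985Averaging, (212) p.50; Balaban1985BackgroundPropagators, (3.19) p.393] -/
theorem lamAvgG_eq_QpIterP12 (L : ℕ) (U₀ : Site d → Fin d → 𝔸ˣ) (lam : Site d → 𝔸) (j : ℕ) :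
    lamAvgG L U₀ j lam = B9Eq3114Proof.P12.QpIter L U₀ lam j := by
  rw [QpIterP12_eq_QpIter, lamAvgG_eq_QpIter]

/-! ## §3 (212) collapsed at a general background -/

/-- **`Q′_j` @gen IS the collapsed (3.19)/(212) operator `QpC`** (offsets parametrisation): for `L ≥ 1`,
`lamAvgG L U₀ j λ y = Σ_{r∈[0,L^j)ᵈ} L^{−jd} • R(U₀(Γ^{(j)}_{y,x_r}))λ(x_r)`, `x_r = L^jy + r` — by §2 and p06's level
peeling `B9Eq357Levels.QpC_eq_QpIter`. [cite: Balaban1985Averaging, (212) p.50; Balaban1985BackgroundPropagators, (3.19) p.393, (3.55) p.401] -/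
theorem lamAvgG_eq_QpC {L : ℕ} (hL : 1 ≤ L) (U₀ : Site d → Fin d → 𝔸ˣ) (lam : Site d → 𝔸) (j : ℕ) (y : Site d) :
    lamAvgG L U₀ j lam y = QpC L U₀ j lam y := by
  rw [QpC_eq_QpIter L hL U₀ lam j y, lamAvgG_eq_QpIter]

/-- **(212), THE LINEAR OPERATOR IN PRINT'S COLLAPSED FORM, AT A GENERAL BACKGROUND** (p. 50: "`Q′_j(u₁, λ, y) =
Σ_{x∈Bʲ(y)} L^{−jd}R(U₀(Γ^{(j)}_{y,x}))λ(x) + …`", (213) "`= (Q′_jλ)(y) + C′_j(u₁, λ, y)`"): for `L ≥ 1`, every background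
`U₀`, datum `λ`, level `j` and site `y` of the `L^j`-lattice (read on `ℤᵈ`),
`(Q′_jλ)(y) = lamAvgG L U₀ j λ y = Σ_{x ∈ Bʲ(y)} L^{−jd} • R(U₀(Γ^{(j)}_{y,x}))λ(x)`,
with `Bʲ(y) = blockSites (L^j) y` (the block `L^jy + [0, L^j)ᵈ`, (3) p. 17), `R(X)Y = XYX⁻¹` (`conjR`, (56)) and
`U₀(Γ^{(j)}_{y,x}) = compT L U₀ j y x` (the composite contour variable (77) / [4] (3.55)).  At `U₀ = 1`: p22's
`B7Eq214FlatQprime.lamAvg_eq_sum_blockSites`. [cite: Balaban1985Averaging, (212)–(213) p.50, (77) p.30, (3) p.17;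
Balaban1985BackgroundPropagators, (3.19) p.393, (3.55) p.401] -/
theorem eq212_collapsed {L : ℕ} (hL : 1 ≤ L) (U₀ : Site d → Fin d → 𝔸ˣ) (lam : Site d → 𝔸) (j : ℕ) (y : Site d) :
    lamAvgG L U₀ j lam y
      = ∑ x ∈ blockSites (L ^ j) y, (((L : ℝ) ^ (j * d))⁻¹) • conjR (compT L U₀ j y x) (lam x) := by
  rw [lamAvgG_eq_QpC hL, QpC, sum_blockSites_eq_sum_boxVec (L ^ j) y]
  refine Finset.sum_congr rfl fun r _ => ?_
  rw [pow_mul, Nat.cast_pow]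
  rfl

/-- (212) collapsed, offsets form: `lamAvgG L U₀ j λ y = Σ_{r : [0,L^j)ᵈ} (L^j)^{−d} • R(compT L U₀ j y x_r)λ(x_r)`,
`x_r = bsite L j y r = L^jy + r` (this is `QpC` unfolded). [cite: Balaban1985Averaging, (212) p.50;
Balaban1985BackgroundPropagators, (3.19) p.393] -/
theorem eq212_collapsed_bsite {L : ℕ} (hL : 1 ≤ L) (U₀ : Site d → Fin d → 𝔸ˣ) (lam : Site d → 𝔸) (j : ℕ)
    (y : Site d) :
    lamAvgG L U₀ j lam y
      = ∑ r : Fin d → Fin (L ^ j),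
          ((((L : ℝ) ^ j) ^ d)⁻¹) • conjR (compT L U₀ j y (bsite L j y r)) (lam (bsite L j y r)) :=
  lamAvgG_eq_QpC hL U₀ lam j y

/-- At the trivial background every composite transporter is `1`: `compT L 1 j y x = 1` (all `Ū₀ˡ = 1`,
`B7Eq92Concrete.avgIter_one`; `B8Eq119TwistedAxial.tg_one`). [cite: Balaban1985Averaging, (77) p.30 at U₀ = 1] -/
theorem compT_one_left (L j : ℕ) (y x : Site d) : compT L (1 : Site d → Fin d → 𝔸ˣ) j y x = 1 := by
  have h1 : (fun l => avgIter L (1 : Site d → Fin d → 𝔸ˣ) l) = fun _ => 1 := funext fun l => avgIter_one L l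
  rw [compT, h1, B8Eq119TwistedAxial.tg_one]
  rfl

/-- Consistency with the flat companion: at `U₀ = 1` the collapsed operator is p22's `j`-fold block mean,
`QpC L 1 j λ y = B7Eq214Flat.lamAvg L j λ y` (`= Σ_{x∈Bʲ(y)} L^{−jd}λ(x)`, `B7Eq214FlatQprime.lamAvg_eq_sum_blockSites`).
[cite: Balaban1985Averaging, (212) p.50 at U₀ = 1] -/
theorem QpC_one_left {L : ℕ} (hL : 1 ≤ L) (lam : Site d → 𝔸) (j : ℕ) (y : Site d) :
    QpC L (1 : Site d → Fin d → 𝔸ˣ) j lam y = lamAvg L j lam y := by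
  rw [← lamAvgG_eq_QpC hL, lamAvgG_one_left]

/-! ## §4 The five tree encodings of `Q′_j(U₀)` agree -/

/-- r04's decl-of-record form `QprimeIter (zdBlocking d L) (transp L U₀)` IS p06's `QpIter`.
[cite: Balaban1985Averaging, (212) p.50; Balaban1985BackgroundPropagators, (3.19) p.393] -/
theorem qprimeIter_transp_eq_QpIter (L : ℕ) (U₀ : Site d → Fin d → 𝔸ˣ) (lam : Site d → 𝔸) (j : ℕ) (z : Site d) :
    QprimeIter (zdBlocking d L) (transp L U₀) j lam z = B9Eq3113Proof.QpIter L U₀ lam j z := by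
  rw [← lamAvgG_eq_QprimeIter, lamAvgG_eq_QpIter]

/-- r05's B8 form `QprimeIter (zdBlocking d L) (bgT L U₀)` ((1.29) transporters) IS p06's `QpIter`.
[cite: Balaban1985Averaging, (212) p.50; Balaban1985RegularSpaces, (1.29) p.81; Balaban1985BackgroundPropagators, (3.19) p.393] -/
theorem qprimeIter_bgT_eq_QpIter (L : ℕ) (U₀ : Site d → Fin d → 𝔸ˣ) (lam : Site d → 𝔸) (j : ℕ) :
    QprimeIter (zdBlocking d L) (bgT L U₀) j lam = B9Eq3113Proof.QpIter L U₀ lam j := by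
  rw [qprimeIter_bgT_eq_lamAvgG, lamAvgG_eq_QpIter]

/-- r04's and r05's transporter encodings give the same `Q′_j`: `QprimeIter … (transp L U₀) = QprimeIter … (bgT L U₀)`.
[cite: Balaban1985Averaging, (77)–(80) p.30, (212) p.50; Balaban1985RegularSpaces, (1.29) p.81] -/
theorem qprimeIter_transp_eq_bgT (L : ℕ) (U₀ : Site d → Fin d → 𝔸ˣ) (lam : Site d → 𝔸) (j : ℕ) (z : Site d) :
    QprimeIter (zdBlocking d L) (transp L U₀) j lam z = QprimeIter (zdBlocking d L) (bgT L U₀) j lam z := by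
  rw [← lamAvgG_eq_QprimeIter, qprimeIter_bgT_eq_lamAvgG]

/-- r04's decl-of-record form, collapsed: `QprimeIter (zdBlocking d L) (transp L U₀) j λ z = QpC L U₀ j λ z` (`L ≥ 1`).
[cite: Balaban1985Averaging, (212) p.50; Balaban1985BackgroundPropagators, (3.19) p.393] -/
theorem qprimeIter_transp_eq_QpC {L : ℕ} (hL : 1 ≤ L) (U₀ : Site d → Fin d → 𝔸ˣ) (lam : Site d → 𝔸) (j : ℕ)
    (z : Site d) : QprimeIter (zdBlocking d L) (transp L U₀) j lam z = QpC L U₀ j lam z := by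
  rw [← lamAvgG_eq_QprimeIter, lamAvgG_eq_QpC hL]

/-- r05's B8 form, collapsed: `QprimeIter (zdBlocking d L) (bgT L U₀) j λ z = QpC L U₀ j λ z` (`L ≥ 1`) — B8 p. 80 "a linear
part of `(1/i) log(R̄₀uʲ)(y)` is equal to `(Q′_j(U₀)λ)(y)`" with `Q′_j(U₀)` in the collapsed form of [4] (3.19).
[cite: Balaban1985RegularSpaces, p.80 (before (1.27)), (1.29) p.81; Balaban1985BackgroundPropagators, (3.19) p.393] -/
theorem qprimeIter_bgT_eq_QpC {L : ℕ} (hL : 1 ≤ L) (U₀ : Site d → Fin d → 𝔸ˣ) (lam : Site d → 𝔸) (j : ℕ)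
    (z : Site d) : QprimeIter (zdBlocking d L) (bgT L U₀) j lam z = QpC L U₀ j lam z := by
  rw [qprimeIter_bgT_eq_lamAvgG, lamAvgG_eq_QpC hL]

/-- p12's carrier, collapsed: `B9Eq3114Proof.P12.QpIter L U₀ λ j z = QpC L U₀ j λ z` (`L ≥ 1`).
[cite: Balaban1985BackgroundPropagators, (3.19) p.393] -/
theorem QpIterP12_eq_QpC {L : ℕ} (hL : 1 ≤ L) (U₀ : Site d → Fin d → 𝔸ˣ) (lam : Site d → 𝔸) (j : ℕ) (z : Site d) :
    B9Eq3114Proof.P12.QpIter L U₀ lam j z = QpC L U₀ j lam z := by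
  rw [← lamAvgG_eq_QpIterP12, lamAvgG_eq_QpC hL]

/-! ## §5 (213)–(214) at a general background with the collapsed operator -/

variable [NormOneClass 𝔸]
variable {L : ℕ} {U₀ : Site d → Fin d → 𝔸ˣ} {k : ℕ} {u' u₁ : Site d → 𝔸ˣ} {α₀ α₃ α₄ : ℝ}

/-- **(213)–(214) AT A GENERAL BACKGROUND, `Q′_jλ` IN THE COLLAPSED FORM (212)** — r04's `B7Eq214General.eq214_general_of52`
restated through `lamAvgG_eq_QpC`: for `U₀` with values in an average-closed `G ⊂ U1` satisfying (52) (`η = L^{−k}`), `u′`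
with (176)/(177), `u₁ ∈ Λ_k(U₀, α₃)` and the explicit smallness of `eq214_general_of52` (`L ≥ 2`), for all `j ≤ k`, `z`:
`‖log ũ′ʲ(z) − Σ_{x∈Bʲ(z)} L^{−jd}R(U₀(Γ^{(j)}_{z,x}))λ(x)‖ ≤ C′_gen(α₃α₄ + α₄²)·LʲL^{−k}`, `λ = log u′`, the sum being
`QpC L U₀ j λ z`, `C′_gen = B7Eq214General.Cgen d`, `ũ′ʲ = B7Prop10General.utilG L U₀ u′ u₁ j`.
[cite: Balaban1985Averaging, (212)–(214) p.50] -/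
theorem eq214_general_QpC (hL : 2 ≤ L) {G : Subgroup 𝔸ˣ} (hG : AvgClosed d L G) (hU : ∀ x κ, U₀ x κ ∈ G)
    (hα : 0 < α₀) (hα3 : C0 d * α₀ ≤ 1 / 3) (hα2 : 2 * α₀ ≤ c2' d L)
    (h52 : pdev U₀ < α₀ * (((L : ℝ) ^ k)⁻¹) ^ 2)
    (h176 : SiteBd u' α₄) (h177 : CovBondBd U₀ u' (α₄ * ((L : ℝ) ^ k)⁻¹))
    (hu₁ : InLambda L U₀ u₁ k α₃ (((L : ℝ) ^ k)⁻¹))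
    (hα₃ : 0 ≤ α₃) (hα₃' : α₃ ≤ 1 / 200) (hα₄ : 0 ≤ α₄)
    (hs₁ : 50 * C6 d * α₄ ≤ 1) (hs₂ : 3000 * ((d : ℝ) + 1) * L * α₄ ≤ 1) (hs₃ : C4G d L * (α₀ + α₃ + α₄) ≤ 1)
    (hs₄ : 1024 * ((d : ℝ) + 1) * ((d : ℝ) + 4) * L ^ 2 * α₀ ≤ 1) (hs₅ : 32 * ((d : ℝ) + 1) ^ 2 * C6 d * L ^ 2 * α₀ ≤ 1)
    (hs₆ : 16 * d * C5' d * C6 d * (L : ℝ) ^ 2 * α₀ ≤ 1) (hs₇ : 8 * d * C6 d * L * α₀ ≤ 1) :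
    ∀ j ≤ k, ∀ z : Site d,
      ‖mlog ((utilG L U₀ u' u₁ j z : 𝔸ˣ) : 𝔸) - QpC L U₀ j (fun x => mlog ((u' x : 𝔸ˣ) : 𝔸)) z‖
        ≤ Cgen d * (α₃ * α₄ + α₄ ^ 2) * ((L : ℝ) ^ j * ((L : ℝ) ^ k)⁻¹) := by
  intro j hj z
  rw [← lamAvgG_eq_QpC (le_trans (by norm_num) hL)]
  exact eq214_general_of52 hL hG hU hα hα3 hα2 h52 h176 h177 hu₁ hα₃ hα₃' hα₄ hs₁ hs₂ hs₃ hs₄ hs₅ hs₆ hs₇ j hj z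

/-- **(213)–(214) at a general background with p06's composite carrier `B9Eq3113Proof.QpIter`** (the `Q′_j(U)` of
[4] (3.19), first form) — same hypotheses and constant. [cite: Balaban1985Averaging, (213)–(214) p.50;
Balaban1985BackgroundPropagators, (3.19) p.393] -/
theorem eq214_general_QpIter (hL : 2 ≤ L) {G : Subgroup 𝔸ˣ} (hG : AvgClosed d L G) (hU : ∀ x κ, U₀ x κ ∈ G)
    (hα : 0 < α₀) (hα3 : C0 d * α₀ ≤ 1 / 3) (hα2 : 2 * α₀ ≤ c2' d L)
    (h52 : pdev U₀ < α₀ * (((L : ℝ) ^ k)⁻¹) ^ 2)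
    (h176 : SiteBd u' α₄) (h177 : CovBondBd U₀ u' (α₄ * ((L : ℝ) ^ k)⁻¹))
    (hu₁ : InLambda L U₀ u₁ k α₃ (((L : ℝ) ^ k)⁻¹))
    (hα₃ : 0 ≤ α₃) (hα₃' : α₃ ≤ 1 / 200) (hα₄ : 0 ≤ α₄)
    (hs₁ : 50 * C6 d * α₄ ≤ 1) (hs₂ : 3000 * ((d : ℝ) + 1) * L * α₄ ≤ 1) (hs₃ : C4G d L * (α₀ + α₃ + α₄) ≤ 1)
    (hs₄ : 1024 * ((d : ℝ) + 1) * ((d : ℝ) + 4) * L ^ 2 * α₀ ≤ 1) (hs₅ : 32 * ((d : ℝ) + 1) ^ 2 * C6 d * L ^ 2 * α₀ ≤ 1)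
    (hs₆ : 16 * d * C5' d * C6 d * (L : ℝ) ^ 2 * α₀ ≤ 1) (hs₇ : 8 * d * C6 d * L * α₀ ≤ 1) :
    ∀ j ≤ k, ∀ z : Site d,
      ‖mlog ((utilG L U₀ u' u₁ j z : 𝔸ˣ) : 𝔸) - B9Eq3113Proof.QpIter L U₀ (fun x => mlog ((u' x : 𝔸ˣ) : 𝔸)) j z‖
        ≤ Cgen d * (α₃ * α₄ + α₄ ^ 2) * ((L : ℝ) ^ j * ((L : ℝ) ^ k)⁻¹) := by
  intro j hj z
  rw [← lamAvgG_eq_QpIter]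
  exact eq214_general_of52 hL hG hU hα hα3 hα2 h52 h176 h177 hu₁ hα₃ hα₃' hα₄ hs₁ hs₂ hs₃ hs₄ hs₅ hs₆ hs₇ j hj z

end Literature.MathematicalPhysics.QuantumFieldTheory.Balaban1983to89.B7Eq212CollapsedGeneral

end
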